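import Summits.AtomisticToContinuum.Crystallization.Theses.ThreeConeCertificate
import Summits.AtomisticToContinuum.Crystallization.Theorems.ThreeConeCertificateDefs
import Summits.AtomisticToContinuum.Crystallization.Theorems.ThreeConeCertificateOnePercentCertificateReduction
import Summits.AtomisticToContinuum.Crystallization.Theorems.TruncatedCensusGap.Negative.KappaZeroHalf

/-!
# Skeleton — crux `OnePercentCertificate` (stmt-AtomisticToContinuum-11958), line `Sketch` (v4, continuation lead c5;
unchanged from lead c1's registered v4, re-registered by c2, c3, c4 and c5)

THE SPLIT (tree objects of `Theorems/ThreeConeCertificateDefs.lean`, namespace `…Theorems.ThreeConeSplit`;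
all data rational; `V_LJ = r⁻¹²/12 − r⁻⁶/6`):

* `fS r = A e^{−a r²} − B e^{−b r²} − (1/12)∫₀ᵀ t² e^{−t r²} dt`, `(A,a,B,b,T) = (21997/100000, 169/100, 3/1000, 81/100, 36/25)`;
* `gS = (V_LJ − fS)·1_{r < 5/2}`, `US = (V_LJ − fS)·1_{r ≥ 5/2}`, `cS = 29/40 − fS 0 / 2 ≈ 0.657987`.

STATUS. Landed and consumed by the tree reductions: `stub_posType_gaussBernstein` (p89377), `stub_bernsteinTail_eq`
(p89784), `stub_tail_le` (p90247) → `OnePercentReduction.onePercentCertificate_of_local : (gS cS-stable) → crux`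
(p112372); `OnePercentPeriodic.local_of_periodicLocalConstant : (∀ P periodic, −cS ≤ e_gS(P)) → (gS cS-stable)`
(p115021, finite-range periodisation).  v4 RESHAPE: the one open stub is now stated in its periodic form

  `stub_periodic : ∀ P : PeriodicConfiguration 3, −cS ≤ P.energyPerParticle gS`

(a finite-range crystallization ENERGY bound in `ℝ³` within `1.03 %`: numerically `min_P e_gS(P) = −0.651259`
at relaxed hcp, fcc `−0.651205`, dhcp `−0.651221`; `cS = 0.657987`).  The composition is the two tree
reductions applied to the stub.  By-product rung landed: `OnePercentTightness.not_threeConeCertificate_of_lt_half`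
(no three-cone certificate of value `< 1/2`, p114802).
-/

noncomputable section

open scoped BigOperators
open Literature.MathematicalPhysics.StatisticalMechanics
open Summit.AtomisticToContinuum.Crystallization.Theorems
open Summit.AtomisticToContinuum.Crystallization.Theorems.ThreeConeSplit

namespace Summit.AtomisticToContinuum.Crystallization.Cruxes.OnePercentCertificate.Sketch

/-! ## Stubs -/

/-- STUB (the periodic local constant — the crux's content). Every periodic configuration of `ℝ³` has
`gS`-energy per particle at least `−cS` (`cS ≈ 0.657987`; the close packings reach `−0.651259`). -/
theorem stub_periodic :
    ∀ P : PeriodicConfiguration 3, -cS ≤ P.energyPerParticle gS := by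
  sorry

/-! ## Composition -/

/-- The finite form of the local constant (the line's former stub `stub_local`), from `stub_periodic` by the
periodisation reduction (the same proof as the landed `OnePercentPeriodic.local_of_periodicLocalConstant`,
p115021, inlined here while that module is unbuilt on the farm): periodise the cluster in a long cubic cell. -/
theorem stub_local :
    ∀ (N : ℕ) (x : Fin N → EuclideanSpace ℝ (Fin 3)), Function.Injective x →
      -(cS * (N : ℝ)) ≤ interactionEnergy gS x := by
  intro N x hx
  rcases Nat.eq_zero_or_pos N with hN | hN
  · subst hN
    rw [interactionEnergy_of_subsingleton]
    simp
  · obtain ⟨P, -, hP⟩ := exists_periodic_energyPerParticle_eq (V := gS) (R := 5 / 2)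
      (fun r hr => gS_eq_zero hr) hx hN
    have hPc := stub_periodic P
    rw [hP] at hPc
    have hNpos : (0 : ℝ) < N := by exact_mod_cast hN
    rw [le_div_iff₀ hNpos] at hPc
    linarith

/-- **Composition.** `stub_periodic` gives the crux `OnePercentCertificate` by name through the landed
reduction `onePercentCertificate_of_local` (witnesses `c := cS`, `g := gS`, `U := US`, `f := fS`). -/
theorem OnePercentCertificate_of :
    Summit.AtomisticToContinuum.Crystallization.Theses.ThreeConeCertificate.OnePercentCertificate :=
  OnePercentReduction.onePercentCertificate_of_local stub_local

end Summit.AtomisticToContinuum.Crystallization.Cruxes.OnePercentCertificate.Sketch
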